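import Mathlib
import Literature.Probability.Moments.HoeffdingNoise
import Summits.PneNP.PneNP.Theorems.OverlapGapAlgebraSearchHardWindowThresholdTails
import Summits.PneNP.PneNP.Theorems.OverlapGapAlgebraSearchHardWindowThresholdRung
import Summits.PneNP.PneNP.Theorems.OverlapGapAlgebraSearchHardWindowSlotRobustClassRung

/-!
# Route OverlapGapAlgebra, crux `SearchHardWindow` (stmt-PneNP-2460): the UNIFORM NOISE-STABILITY
# rung — every uniformly noise-stable class of output maps fails

O'Donnell (2014, Def. 5.34) calls a class of Boolean functions *uniformly noise-stable* if
`NS_δ[g] ≤ e(δ)` for all its members with `e(δ) → 0` as `δ → 0`. On the literal-slot product space of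
`F_k(n, m)` take resampling noise at rate `δ = 1/M`: each of the `m k` slots of `Φ` is independently
replaced by a fresh uniform literal with probability `1/M` — equivalently, label the slots uniformly
at random by `M` blocks and resample one uniformly random block from an independent copy `Ψ`. In
counting form, `NS_{1/M}[g] = (Σ_P Σ_b #{(Φ, Ψ) : g Φ ≠ g (Φ with block b := P⁻¹ b taken from Ψ)})`
`/ (M · M^{mk} · #Inst²)`.

**Theorem (`uniformlyNoiseStableRung`).** There is `k₀` such that for all `k ≥ k₀` and every rate
function `e : ℕ → ℝ` with `e(M) → 0`, for every `ε > 0`, eventually in `n`, with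
`m = ⌊5 · 2^k log k / k · n⌋`: every map all of whose output bits satisfy `NS_{1/M}[g_v] ≤ e(M)` for
all `M ≥ 1` outputs a satisfying assignment of `Φ ∼ F_k(n, m)` for at most `ε · #instances`
instances. Contrapositively: the output bits of any solver that succeeds with probability `≥ ε`
infinitely often are NOT uniformly noise-stable — at some fixed noise rate `1/M` (depending on `k`,
`ε` only) some bit has noise sensitivity bounded below, infinitely often.

This is the common roof of this session's rungs: additive-threshold statistics (Peres:
`e(M) = M^{-1/2}` for every labelling), functions of `s` of them (`e = s M^{-1/2}`); it is
incomparable with the low-influence rung (`NS_δ ≤ 1/log(1/δ)` allows total influence `n / log n`).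
Proof: the tail argument of `shwT_tail_le` with the AVERAGED resampling bound
(`shwT_tail_le_of_sum_resample_le`: `Σ_{|S| ≥ d} ‖G^{=S}‖² ≤ 4 e(d) · #points`), a constant level
`d(τ)` with `e(d) ≤ τ/4`, and `slotRobustClassRung`. No new definitions; axioms standard.

References: R. O'Donnell, *Analysis of Boolean Functions* (2014), Def. 5.34, Prop. 3.3, §8.3
[ODonnell2014]; Y. Peres, arXiv:math/0412377 [Peres2004].
-/

set_option linter.dupNamespace false -- `Summit.PneNP.PneNP.…`: summit = sub-problem (D-0017)

noncomputable section

namespace Summit.PneNP.PneNP.Theorems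

open Finset Filter Asymptotics
open Literature.Computability.Complexity
open Literature.Probability.Moments
open scoped Classical

/-- **Tails from AVERAGED resampling counts** (the argument of `shwT_tail_le`, abstracted): if,
summed over all block labellings `P : ι → Fin d` (`d ≥ 1`) and blocks `j`, the number of pairs on
which resampling block `j` changes `g` is `≤ B · #labellings · #(ι → Γ)²` (i.e. `d · NS_{1/d}[g] ≤ B`),
then `Σ_{|S| ≥ d} ‖G^{=S}‖² ≤ (4B/d) · #(ι → Γ)` for `G = (±1)^g`. [cite: ODonnell2014, §3.1 Prop. 3.3] -/
theorem shwT_tail_le_of_sum_resample_le {ι Γ : Type*} [Fintype ι] [DecidableEq ι] [Fintype Γ]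
    [Nonempty Γ] (g : (ι → Γ) → Bool) (d : ℕ) (hd : 1 ≤ d) (B : ℝ)
    (hB : ∑ P : ι → Fin d, ∑ j : Fin d, ((univ.filter fun p : (ι → Γ) × (ι → Γ) =>
        g p.1 ≠ g ((univ.filter fun i => P i = j).piecewise p.2 p.1)).card : ℝ)
      ≤ B * Fintype.card (ι → Fin d) * (Fintype.card (ι → Γ) : ℝ) ^ 2) :
    ∑ S ∈ (univ : Finset ι).powerset.filter (fun S => d ≤ S.card),
        ∑ y, hoeffdingComp S (fun y => if g y then (1 : ℝ) else -1) y ^ 2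
      ≤ 4 * B / d * Fintype.card (ι → Γ) := by
  haveI : NeZero d := ⟨by omega⟩
  have hNf : (0 : ℝ) < Fintype.card (ι → Γ) := by exact_mod_cast Fintype.card_pos
  have hNP : (0 : ℝ) < Fintype.card (ι → Fin d) := by exact_mod_cast Fintype.card_pos
  have hdpos : (0 : ℝ) < d := by exact_mod_cast hd
  have hb0 : ∀ S : Finset ι,
      0 ≤ ∑ y, hoeffdingComp S (fun y => if g y then (1 : ℝ) else -1) y ^ 2 :=
    fun S => sum_nonneg fun y _ => sq_nonneg _
  -- (1) the moving part at one block is a resampling count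
  have h1 : ∀ (P : ι → Fin d) (j : Fin d),
      (Fintype.card (ι → Γ) : ℝ) *
        ∑ S ∈ (univ : Finset ι).powerset.filter
          (fun S => ¬ Disjoint S (univ.filter fun i => P i = j)),
          ∑ y, hoeffdingComp S (fun y => if g y then (1 : ℝ) else -1) y ^ 2 =
      2 * ((univ.filter fun p : (ι → Γ) × (ι → Γ) =>
        g p.1 ≠ g ((univ.filter fun i => P i = j).piecewise p.2 p.1)).card : ℝ) := by
    intro P j
    have h := card_resample_ne_eq (univ.filter fun i => P i = j) g
    linarith
  -- (2) summed over blocks and labellings: the hypothesis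
  have h2 : ∑ P : ι → Fin d, ∑ j : Fin d, (Fintype.card (ι → Γ) : ℝ) *
        ∑ S ∈ (univ : Finset ι).powerset.filter
          (fun S => ¬ Disjoint S (univ.filter fun i => P i = j)),
          ∑ y, hoeffdingComp S (fun y => if g y then (1 : ℝ) else -1) y ^ 2 ≤
      Fintype.card (ι → Fin d) * (2 * (B * (Fintype.card (ι → Γ) : ℝ) ^ 2)) := by
    calc ∑ P : ι → Fin d, ∑ j : Fin d, (Fintype.card (ι → Γ) : ℝ) *
          ∑ S ∈ (univ : Finset ι).powerset.filter
            (fun S => ¬ Disjoint S (univ.filter fun i => P i = j)),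
            ∑ y, hoeffdingComp S (fun y => if g y then (1 : ℝ) else -1) y ^ 2
        = ∑ P : ι → Fin d, 2 * ∑ j : Fin d, ((univ.filter fun p : (ι → Γ) × (ι → Γ) =>
            g p.1 ≠ g ((univ.filter fun i => P i = j).piecewise p.2 p.1)).card : ℝ) := by
          refine sum_congr rfl fun P _ => ?_
          rw [mul_sum]
          exact sum_congr rfl fun j _ => h1 P j
      _ = 2 * ∑ P : ι → Fin d, ∑ j : Fin d, ((univ.filter fun p : (ι → Γ) × (ι → Γ) =>
            g p.1 ≠ g ((univ.filter fun i => P i = j).piecewise p.2 p.1)).card : ℝ) := by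
          rw [mul_sum]
      _ ≤ Fintype.card (ι → Fin d) * (2 * (B * (Fintype.card (ι → Γ) : ℝ) ^ 2)) := by
          nlinarith [hB]
  -- (3) exchange the sums
  have h3 : ∑ P : ι → Fin d, ∑ j : Fin d, (Fintype.card (ι → Γ) : ℝ) *
        ∑ S ∈ (univ : Finset ι).powerset.filter
          (fun S => ¬ Disjoint S (univ.filter fun i => P i = j)),
          ∑ y, hoeffdingComp S (fun y => if g y then (1 : ℝ) else -1) y ^ 2 =
      (Fintype.card (ι → Γ) : ℝ) * ∑ S ∈ (univ : Finset ι).powerset,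
        (∑ y, hoeffdingComp S (fun y => if g y then (1 : ℝ) else -1) y ^ 2) *
        ∑ P : ι → Fin d, ((univ.filter fun j : Fin d =>
          ¬ Disjoint S (univ.filter fun i => P i = j)).card : ℝ) := by
    simp only [← mul_sum]
    congr 1
    simp only [sum_filter]
    refine (sum_congr rfl fun P _ => sum_comm).trans ?_
    rw [sum_comm]
    refine sum_congr rfl fun S _ => ?_
    rw [mul_sum]
    refine sum_congr rfl fun P _ => ?_
    rw [card_eq_sum_ones, Nat.cast_sum, sum_filter, mul_sum]
    refine sum_congr rfl fun j _ => ?_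
    split_ifs <;> simp
  -- (4) keep only the sets of size `≥ d`
  have h4 : (d : ℝ) / 2 * Fintype.card (ι → Fin d) *
      ∑ S ∈ (univ : Finset ι).powerset.filter (fun S => d ≤ S.card),
        ∑ y, hoeffdingComp S (fun y => if g y then (1 : ℝ) else -1) y ^ 2 ≤
      ∑ S ∈ (univ : Finset ι).powerset,
        (∑ y, hoeffdingComp S (fun y => if g y then (1 : ℝ) else -1) y ^ 2) *
        ∑ P : ι → Fin d, ((univ.filter fun j : Fin d =>
          ¬ Disjoint S (univ.filter fun i => P i = j)).card : ℝ) := by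
    rw [mul_sum]
    calc ∑ S ∈ (univ : Finset ι).powerset.filter (fun S => d ≤ S.card),
          (d : ℝ) / 2 * Fintype.card (ι → Fin d) *
            ∑ y, hoeffdingComp S (fun y => if g y then (1 : ℝ) else -1) y ^ 2
        ≤ ∑ S ∈ (univ : Finset ι).powerset.filter (fun S => d ≤ S.card),
          (∑ y, hoeffdingComp S (fun y => if g y then (1 : ℝ) else -1) y ^ 2) *
            ∑ P : ι → Fin d, ((univ.filter fun j : Fin d =>
              ¬ Disjoint S (univ.filter fun i => P i = j)).card : ℝ) := by
          refine sum_le_sum fun S hS => ?_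
          rw [mul_comm]
          exact mul_le_mul_of_nonneg_left (shwT_bins d hd S (mem_filter.1 hS).2) (hb0 S)
      _ ≤ _ := by
          refine sum_le_sum_of_subset_of_nonneg (filter_subset _ _) fun S _ _ => ?_
          exact mul_nonneg (hb0 S) (sum_nonneg fun P _ => Nat.cast_nonneg _)
  -- (5) combine and divide
  have hM : (0 : ℝ) < Fintype.card (ι → Γ) * ((d : ℝ) / 2 * Fintype.card (ι → Fin d)) := by
    positivity
  have key : Fintype.card (ι → Γ) * ((d : ℝ) / 2 * Fintype.card (ι → Fin d)) *
      ∑ S ∈ (univ : Finset ι).powerset.filter (fun S => d ≤ S.card),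
        ∑ y, hoeffdingComp S (fun y => if g y then (1 : ℝ) else -1) y ^ 2 ≤
      Fintype.card (ι → Fin d) * (2 * (B * (Fintype.card (ι → Γ) : ℝ) ^ 2)) := by
    rw [mul_assoc]
    refine le_trans (mul_le_mul_of_nonneg_left h4 hNf.le) ?_
    rw [← h3]
    exact h2
  have heq : (Fintype.card (ι → Fin d) : ℝ) * (2 * (B * (Fintype.card (ι → Γ) : ℝ) ^ 2)) =
      Fintype.card (ι → Γ) * ((d : ℝ) / 2 * Fintype.card (ι → Fin d)) *
        (4 * B / d * Fintype.card (ι → Γ)) := by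
    field_simp
    ring
  rw [heq] at key
  exact le_of_mul_le_mul_left key hM


/-- **The uniform noise-stability rung (unconditional).** See the module docstring: for `k ≥ k₀`,
`e(M) → 0`, `ε > 0`, eventually in `n`, every map `g` with
`Σ_P Σ_b #{(Φ, Ψ) : g v Φ ≠ g v (Φ ⊕_{P⁻¹ b} Ψ)} ≤ e(M) · M · M^{mk} · #Inst²` for all `v` and `M ≥ 1`
(`NS_{1/M}[g_v] ≤ e(M)`) solves at most `ε · #instances` instances of `F_k(n, ⌊α_k n⌋)`.
[cite: ODonnell2014, §5.5 Def. 5.34] -/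
theorem uniformlyNoiseStableRung :
    ∃ k₀ : ℕ, ∀ k : ℕ, k₀ ≤ k → ∀ e : ℕ → ℝ, Tendsto e atTop (nhds 0) →
      ∀ ε : ℝ, 0 < ε →
      ∀ᶠ n : ℕ in atTop, ∀ m : ℕ, m = ⌊5 * 2 ^ k * Real.log k / k * n⌋₊ →
        ∀ g : Fin n → (Fin m → Fin k → Fin n × Bool) → Bool,
          (∀ (v : Fin n) (M : ℕ), 1 ≤ M → ∑ P : Fin m × Fin k → Fin M, ∑ b : Fin M,
              ((univ.filter fun q : (Fin m → Fin k → Fin n × Bool) × (Fin m → Fin k → Fin n × Bool) =>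
                g v q.1 ≠ g v (fun i j => if P (i, j) = b then q.2 i j else q.1 i j)).card : ℝ)
            ≤ e M * M * Fintype.card (Fin m × Fin k → Fin M) *
              (Fintype.card (Fin m → Fin k → Fin n × Bool) : ℝ) ^ 2) →
          ((univ.filter fun Φ : Fin m → Fin k → Fin n × Bool =>
              ∀ i : Fin m, ∃ j : Fin k, g (Φ i j).1 Φ = (Φ i j).2).card : ℝ)
            ≤ ε * Fintype.card (Fin m → Fin k → Fin n × Bool) := by
  obtain ⟨k₀, hk₀⟩ := slotRobustClassRung
  refine ⟨k₀, fun k hk e he ε hε => ?_⟩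
  -- the class: slot-space maps with `M · NS_{1/M} ≤ e(M) M` for all `M ≥ 1`
  set 𝒢 : (n m : ℕ) → ((Fin m × Fin k → Fin n × Bool) → Bool) → Prop := fun n m g =>
    ∀ M : ℕ, 1 ≤ M → ∑ P : Fin m × Fin k → Fin M, ∑ b : Fin M,
      ((univ.filter fun p : (Fin m × Fin k → Fin n × Bool) × (Fin m × Fin k → Fin n × Bool) =>
        g p.1 ≠ g ((univ.filter fun s => P s = b).piecewise p.2 p.1)).card : ℝ)
      ≤ e M * M * Fintype.card (Fin m × Fin k → Fin M) *
        (Fintype.card (Fin m × Fin k → Fin n × Bool) : ℝ) ^ 2 with h𝒢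
  have hclass : ∀ τ : ℝ, 0 < τ → ∃ D : ℕ → ℕ,
      (fun n : ℕ => (D n : ℝ)) =o[atTop] (fun n : ℕ => (n : ℝ) / Real.log n ^ 2) ∧
      ∀ᶠ n : ℕ in atTop, ∀ (m : ℕ) (g : (Fin m × Fin k → Fin n × Bool) → Bool), 𝒢 n m g →
        ∑ y : Fin m × Fin k → Fin n × Bool, ((if g y then (1 : ℝ) else -1) -
          ∑ T ∈ (univ : Finset (Fin m × Fin k)).powerset.filter (fun T => T.card < D n),
            hoeffdingComp T (fun y => if g y then (1 : ℝ) else -1) y) ^ 2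
          ≤ τ * Fintype.card (Fin m × Fin k → Fin n × Bool) := by
    intro τ hτ
    -- a constant level `d ≥ 1` with `e d ≤ τ / 4`
    obtain ⟨d, hd⟩ := Filter.eventually_atTop.1
      ((he.eventually (Metric.ball_mem_nhds (0 : ℝ) (by positivity : (0 : ℝ) < τ / 4))).and
        (eventually_ge_atTop 1))
    have hd1 : 1 ≤ d := (hd d le_rfl).2
    have hed : e d ≤ τ / 4 := by
      have h : dist (e d) 0 < τ / 4 := (hd d le_rfl).1
      rw [Real.dist_eq, sub_zero] at h
      exact (le_abs_self _).trans h.le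
    refine ⟨fun _ => d, shwT_const_isLittleO d, ?_⟩
    filter_upwards [eventually_ge_atTop 1] with n hn1 m g hg
    haveI : Nonempty (Fin n × Bool) := ⟨(⟨0, hn1⟩, true)⟩
    rw [sum_sq_sub_truncation_eq]
    have hdpos : (0 : ℝ) < d := by exact_mod_cast hd1
    have hB := hg d hd1
    have htail := shwT_tail_le_of_sum_resample_le g d hd1 (e d * d) (by
      simpa only [mul_assoc] using hB)
    refine htail.trans (mul_le_mul_of_nonneg_right ?_ (Nat.cast_nonneg _))
    rw [show 4 * (e d * d) / d = 4 * e d by field_simp]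
    linarith
  have hev := hk₀ k hk 𝒢 hclass ε hε
  filter_upwards [hev] with n hn m hm g hg
  refine hn m hm g fun v => ?_
  -- membership: re-index the instance pairs through `curry`
  intro M hM
  have hcardEq : (Fintype.card (Fin m × Fin k → Fin n × Bool) : ℝ) =
      Fintype.card (Fin m → Fin k → Fin n × Bool) := by
    rw [Fintype.card_congr (Equiv.curry (Fin m) (Fin k) (Fin n × Bool))]
  rw [hcardEq]
  refine le_of_eq_of_le (sum_congr rfl fun P _ => sum_congr rfl fun b _ => ?_) (hg v M hM)
  congr 1
  refine card_equiv ((Equiv.curry (Fin m) (Fin k) (Fin n × Bool)).prodCongr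
    (Equiv.curry (Fin m) (Fin k) (Fin n × Bool))) ?_
  intro q
  have hpw : Function.curry ((univ.filter fun s : Fin m × Fin k => P s = b).piecewise q.2 q.1) =
      fun i j => if P (i, j) = b then Function.curry q.2 i j else Function.curry q.1 i j := by
    funext i j
    simp [Finset.piecewise, Function.curry]
  simp only [mem_filter, mem_univ, true_and, Equiv.prodCongr_apply, Prod.map_fst, Prod.map_snd,
    Equiv.curry_apply, hpw]

end Summit.PneNP.PneNP.Theorems

end
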